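import Literature.AnabelianGeometry.EtaleTheta.Discharge.Sec3ConstantLineOfRlfQR
import Literature.AnabelianGeometry.EtaleTheta.TemperedFrobenioidToy
import HarnessLib

/-!
# [EtTh] Prop 3.4 (ii), THIRD isomorphism `L^× ⥲ F₀(Y^log)` and the valuation description of constants —
# ONE predicate bundle over the Def 3.3 (iii) data (post-freeze class (c): no field of a frozen structure touched)

S. Mochizuki, *The étale theta function …*, Publ. RIMS **45** (2009) [MochizukiEtTh2009], Prop 3.4 (ii) PDF p.74:
"Suppose that `Y^log` is geometrically connected over a finite extension `L` of `K`.  Then we have natural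
isomorphisms `O_L^× ⥲ Ker(B₀(Y^log) → Φ₀^gp(Y^log))`; `O_L^▷ ⥲ B₀(Y^log) ×_{Φ₀^gp(Y^log)} Φ₀(Y^log)`;
`L^× ⥲ F₀(Y^log)`" [cite: MochizukiEtTh2009, Prop 3.4 (ii) p.74]; Def 3.1 (i)/(ii) PDF p.70: log-divisors are
supported in "the union of the special fiber and the divisor of cusps", log-meromorphic functions/constants are
those of finite étale base-changes of the model over `O_L`.

WHY THIS FILE.  abc-iut-L2-t3's hypothesis structure `DivisorMonoids.Prop34` (`DivisorMonoids.lean`, frozen) renders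
Prop 3.4 (i) and the FIRST TWO isomorphisms of (ii) (`ker_div₀_le_F₀`, `mem_F₀_of_div₀_mem`); the THIRD isomorphism
`L^× ⥲ F₀(Y^log)` — `F₀(Y)` is a GROUP whose log-divisors are the integral multiples `v_L(c)·div(ϖ_L)` of the
(non-cuspidal, nonzero) log-divisor of the special fibre — was left out, and the cell's §3 discharges carry it as
NAMED BINDERS (abc-iut-w5-d135's §3 interface census v2, «Net» (1)+(2); GAP row G-L2d2-3): `hF₀inv`
(`Discharge/Sec3FLambdaInvOfRlf`, `…/Sec3ConstantLineOfRlfQR`), `hcyc` (`…/Sec3ConstantLineOfRlfZ/QR`), `hcn`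
(`DivisorMonoidsCuspidalWeak`/`NoPhantomSupport` lineage, G-L2d2-3).  As the §3 interface owner this file supplies
the omitted clause as ONE `Prop`-valued predicate bundle `DivisorMonoids.Prop34Const` over the EXISTING structure
(the L2 DEFS-FREEZE's class (c): no field added to `DivisorMonoids`; consumers take `(hC : dm.Prop34Const)` BY NAME),
derives the three binders in the consumers' VERBATIM shapes (`Prop34Const.hF₀inv` / `.hcyc` / `.hcn`), feeds the
Def 3.6 (ii)(b) bracketed-sentence closers of abc-iut-w4-d008 at all three monoid types (`…_of_prop34Const`), and
witnesses non-vacuity at the cell's toy Def 3.3 (iii) data (`Toy.prop34Const`: `Φ₀ = ℕ`, `B₀ = F₀ = ℤ`).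
NOT here (different objects/owners): torsion-faithfulness of `Aut` on `Ker div₀` (Thm 3.7 (iii) at `Λ = ℚ`, GAP
G-w4d084-2 — lives with `Prop34Cnst₀`/`cnst`), `Countable (Primes (Φ(A))^pf)` (G-L2d2-4), the monoid type of Def 3.6
as data (13:00Z v-next window).  HONEST FRAMING: refereed pre-IUT material; a property of the GENUINE geometric data
recorded as an explicit hypothesis predicate, never asserted for abstract data; nothing here bears on [IUTchIII]
Cor. 3.12; typed ≠ proved.
-/

noncomputable section

namespace Literature.AnabelianGeometry.EtaleTheta

open CategoryTheory Opposite Literature.AlgebraicGeometry.Frobenioids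

universe u₀ v₀ u v w

namespace DivisorMonoids

variable {D₀ : Type u} [Category.{v} D₀] (T : DivisorMonoids.{u, v, w} D₀)

/-- **Proposition 3.4 (ii), third isomorphism `L^× ⥲ F₀(Y^log)`, with the valuation description of the constants**
(p.74; Def 3.1 (i)/(ii) p.70), as a hypothesis predicate on the Def 3.3 (iii) data `T` (what the geometric
`Φ₀, B₀, F₀` satisfy; for abstract data an explicit hypothesis): (a) `F₀(Y) ≅ L^×` is a subgroup of the group of
log-meromorphic functions; (b) there is a NON-CUSPIDAL, nonzero log-divisor `d_Y` ("`div(ϖ_L)`", the special fibre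
with multiplicities), attained as the log-divisor of a constant (`ϖ_L ∈ L^×`), such that the log-divisor of every
constant is an integral power `v_L(c)·d_Y` of it (`O_L^▷ ≅ B₀ ×_{Φ₀^gp} Φ₀`, `L^× = ϖ_L^ℤ · O_L^×`).
[cite: MochizukiEtTh2009, Prop 3.4 (ii) p.74] -/
structure Prop34Const : Prop where
  /-- (a) "`L^× ⥲ F₀(Y^log)`": `F₀(Y)` is closed under inverses in `B₀(Y)` -/
  inv_mem_F₀ : ∀ (Y : D₀ᵒᵖ) (b : T.B₀.obj Y), b ∈ T.F₀ Y → ∃ b' ∈ T.F₀ Y, b' * b = 1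
  /-- (b) "`div₀(c) = v_L(c) · div(ϖ_L)`", `div(ϖ_L) ≠ 0` non-cuspidal and attained by `ϖ_L ∈ L^× ≅ F₀(Y)` -/
  exists_specialFibre : ∀ Y : D₀ᵒᵖ, ∃ d ∈ T.ncsp₀ Y, d ≠ 1 ∧
    (∃ ϖ ∈ T.F₀ Y, T.div₀ Y ϖ = Algebra.GrothendieckGroup.of d) ∧
    ∀ b ∈ T.F₀ Y, ∃ n : ℤ, T.div₀ Y b = Algebra.GrothendieckGroup.of d ^ n

namespace Prop34Const

variable {T}

/-- The binder **`hF₀inv`** of `Discharge/Sec3FLambdaInvOfRlf` / `Sec3ConstantLineOfRlfQR` (verbatim shape), BY NAME.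
[cite: MochizukiEtTh2009, Prop 3.4 (ii) p.74] -/
theorem hF₀inv (h : T.Prop34Const) : ∀ (Y : D₀ᵒᵖ) (b : T.B₀.obj Y), b ∈ T.F₀ Y → ∃ b' ∈ T.F₀ Y, b' * b = 1 :=
  h.inv_mem_F₀

/-- The binder **`hcyc`** of `Discharge/Sec3ConstantLineOfRlfZ` / `…QR` (verbatim shape: "`div₀(c) = dⁿ`"), BY NAME.
[cite: MochizukiEtTh2009, Prop 3.4 (ii) p.74] -/
theorem hcyc (h : T.Prop34Const) : ∀ Y : D₀ᵒᵖ, ∃ d : T.Φ₀.obj Y, ∀ b ∈ T.F₀ Y, ∃ n : ℤ,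
    T.div₀ Y b = Algebra.GrothendieckGroup.of d ^ n := fun Y => by
  obtain ⟨d, -, -, -, hd⟩ := h.exists_specialFibre Y
  exact ⟨d, hd⟩

/-- The binder **`hcn`** of GAP row G-L2d2-3 (verbatim shape: "the divisor of a constant function is a quotient of
NON-CUSPIDAL log-divisors"), PROVED from (b): `dⁿ = dⁿ/1` for `n ≥ 0`, `= 1/d⁻ⁿ` for `n < 0`.
[cite: MochizukiEtTh2009, Prop 3.4 (ii) p.74] -/
theorem hcn (h : T.Prop34Const) (Y : D₀ᵒᵖ) (b : T.B₀.obj Y) (hb : b ∈ T.F₀ Y) :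
    ∃ n₁ n₂ : T.Φ₀.obj Y, n₁ ∈ T.ncsp₀ Y ∧ n₂ ∈ T.ncsp₀ Y ∧
      T.div₀ Y b * Algebra.GrothendieckGroup.of n₂ = Algebra.GrothendieckGroup.of n₁ := by
  obtain ⟨d, hd, -, -, hdiv⟩ := h.exists_specialFibre Y
  obtain ⟨n, hn⟩ := hdiv b hb
  obtain ⟨k, rfl | rfl⟩ := n.eq_nat_or_neg
  · exact ⟨d ^ k, 1, pow_mem hd k, one_mem _, by rw [hn, zpow_natCast, map_one, mul_one, map_pow]⟩
  · exact ⟨1, d ^ k, one_mem _, pow_mem hd k, by rw [hn, zpow_neg, zpow_natCast, map_pow, map_one, inv_mul_cancel]⟩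

/-- A constant with NONZERO, EFFECTIVE, NON-CUSPIDAL log-divisor exists (`ϖ_L`; cf. the bracketed sentence of
Def 3.6 (ii)(b), binder `hNZ` of row C38-L05). [cite: MochizukiEtTh2009, Prop 3.4 (ii) p.74] -/
theorem exists_cnst_div₀_eq_of (h : T.Prop34Const) (Y : D₀ᵒᵖ) :
    ∃ ϖ ∈ T.F₀ Y, ∃ d ∈ T.ncsp₀ Y, d ≠ 1 ∧ T.div₀ Y ϖ = Algebra.GrothendieckGroup.of d := by
  obtain ⟨d, hd, hd1, ⟨ϖ, hϖ, hdiv⟩, -⟩ := h.exists_specialFibre Y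
  exact ⟨ϖ, hϖ, d, hd, hd1, hdiv⟩

/-- `F₀(Y)` is inverse-closed: the inverse (in the group-like `B₀(Y)`) of a constant is a constant.
[cite: MochizukiEtTh2009, Prop 3.4 (ii) p.74] -/
theorem inv_mem (h : T.Prop34Const) (Y : D₀ᵒᵖ) {b : T.B₀.obj Y} (hb : b ∈ T.F₀ Y) :
    ((T.isUnit_B₀ Y b).unit⁻¹ : (T.B₀.obj Y)ˣ).val ∈ T.F₀ Y := by
  obtain ⟨b', hb', e⟩ := h.inv_mem_F₀ Y b hb
  have : ((T.isUnit_B₀ Y b).unit⁻¹ : (T.B₀.obj Y)ˣ).val = b' := by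
    apply Units.inv_eq_of_mul_eq_one_left
    rw [IsUnit.unit_spec]
    exact e
  rw [this]
  exact hb'

end Prop34Const

end DivisorMonoids

/-! ### The Def 3.6 (ii)(b) bracketed-sentence closers of abc-iut-w4-d008, fed BY NAME at all three monoid types -/

namespace TemperedFrobenioid

variable {D₀ : Type u} [Category.{v} D₀] {dm : DivisorMonoids.{u, v, w} D₀}
  {hpf : ∀ Y : D₀ᵒᵖ, IsPerfFactorial (dm.Φ₀.obj Y)} {D : Type u₀} [Category.{v₀} D] {VD : FrdICatStub.{u₀, v₀, w} D}

/-- **Def 3.6 (ii)(b), bracketed sentence, over `ofRlfZ dm hpf`** ⇐ `dm.Prop34Const` ALONE (no `Prop34`):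
`exists_cnstFn_effective_ofRlfZ_of_inv` with `hF₀inv`, `hcyc` supplied by the bundle. [cite: MochizukiEtTh2009, Def 3.6 p.77] -/
theorem exists_cnstFn_effective_ofRlfZ_of_prop34Const
    (C₀ : TemperedFrobenioid (RealifiedDivisorMonoids.ofRlfZ dm hpf) D VD) (hC : dm.Prop34Const) (A : Dᵒᵖ) :
    ∃ u : ((RealifiedDivisorMonoids.ofRlfZ dm hpf).BΛ.obj (C₀.baseOp A) : Type w) ×
        Algebra.GrothendieckGroup (C₀.Φ.carrier A),
      u ∈ C₀.cnstFn A ∧ ∃ Z : C₀.Φ.carrier A, Z ≠ 1 ∧ u.2 = Algebra.GrothendieckGroup.of Z :=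
  C₀.exists_cnstFn_effective_ofRlfZ_of_inv hC.hF₀inv hC.hcyc A

/-- **Def 3.6 (ii)(b), bracketed sentence, over `ofRlfQ dm hpf`** ⇐ `dm.Prop34Const` ALONE.
[cite: MochizukiEtTh2009, Def 3.6 p.77] -/
theorem exists_cnstFn_effective_ofRlfQ_of_prop34Const
    (C₀ : TemperedFrobenioid (RealifiedDivisorMonoids.ofRlfQ dm hpf) D VD) (hC : dm.Prop34Const) (A : Dᵒᵖ) :
    ∃ u : ((RealifiedDivisorMonoids.ofRlfQ dm hpf).BΛ.obj (C₀.baseOp A) : Type w) ×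
        Algebra.GrothendieckGroup (C₀.Φ.carrier A),
      u ∈ C₀.cnstFn A ∧ ∃ Z : C₀.Φ.carrier A, Z ≠ 1 ∧ u.2 = Algebra.GrothendieckGroup.of Z :=
  C₀.exists_cnstFn_effective_ofRlfQ_of_inv hC.hF₀inv hC.hcyc A

/-- **Def 3.6 (ii)(b), bracketed sentence, over `ofRlfR dm hpf`** ⇐ `dm.Prop34Const` (only its `hcyc` is used; the
inverse-closure of `F₀^ℝ = ℝ·Φ₀^cnst ∩ B₀^ℝ` holds by construction, abc-iut-w5-d135). [cite: MochizukiEtTh2009, Def 3.6 p.77] -/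
theorem exists_cnstFn_effective_ofRlfR_of_prop34Const
    (C₀ : TemperedFrobenioid (RealifiedDivisorMonoids.ofRlfR dm hpf) D VD) (hC : dm.Prop34Const) (A : Dᵒᵖ) :
    ∃ u : ((RealifiedDivisorMonoids.ofRlfR dm hpf).BΛ.obj (C₀.baseOp A) : Type w) ×
        Algebra.GrothendieckGroup (C₀.Φ.carrier A),
      u ∈ C₀.cnstFn A ∧ ∃ Z : C₀.Φ.carrier A, Z ≠ 1 ∧ u.2 = Algebra.GrothendieckGroup.of Z :=
  C₀.exists_cnstFn_effective_ofRlfR hC.hcyc A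

end TemperedFrobenioid

/-! ### Non-vacuity: the bundle holds at the cell's toy Def 3.3 (iii) data -/

namespace Toy

/-- **Non-vacuity witness**: `Prop34Const` holds for `Toy.divisorMonoids` (`Φ₀ = ℕ` with the one prime `𝔭`,
`B₀ = F₀ = ℤ`, `div₀(n) = 𝔭ⁿ`, everything non-cuspidal): `F₀ = ℤ` is a group and `d = 𝔭 = div₀(1)`.
[cite: MochizukiEtTh2009, Prop 3.4 (ii) p.74] -/
theorem prop34Const : divisorMonoids.Prop34Const where
  inv_mem_F₀ Y b _ := ⟨_, trivial, Units.inv_mul_of_eq (divisorMonoids.isUnit_B₀ Y b).unit_spec⟩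
  exists_specialFibre Y := by
    refine ⟨(Multiplicative.ofAdd (1 : ℕ) : Multiplicative ℕ), trivial, ?_,
      ⟨(Multiplicative.ofAdd (1 : ℤ) : Multiplicative ℤ), trivial, ?_⟩, fun b _ => ?_⟩
    · intro e
      have h1 := congrArg Multiplicative.toAdd e
      change (1 : ℕ) = 0 at h1
      exact Nat.one_ne_zero h1
    · exact divHom_ofAdd_one
    · refine ⟨(Multiplicative.toAdd : Multiplicative ℤ ≃ ℤ) b, ?_⟩
      change divHom b = Algebra.GrothendieckGroup.of (Multiplicative.ofAdd (1 : ℕ)) ^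
        (Multiplicative.toAdd : Multiplicative ℤ ≃ ℤ) b
      rw [divHom, zpowersHom_apply]

end Toy

end Literature.AnabelianGeometry.EtaleTheta

end
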